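import Literature.Analysis.FluidPDE.KNSSMildDecayHorizontal
import Literature.Analysis.FluidPDE.NSBoundedMildOseenDuhamel
import Literature.Analysis.FluidPDE.NewtonPotentialHolder
import Literature.Analysis.FluidPDE.KatoFixedPointMildBesov
import HarnessLib

/-!
# Route `LerayQuarterDissipation`, item `RecurrentReductionD` (stmt-NavierStokesRegularity-22507):
# kernel bookkeeping for the sup-norm ε-regularity of the finite-dissipation stratum

Helper file (theorems only, `--supports` the item). The persistence of the apex singularity
for the finite-dissipation Type-I class `𝒟` is proved (in the sequel files) by a direct
sup-norm bootstrap on the Oseen integral equation `v(t) = e^{(t−t₁)Δ}v(t₁) − B_{t₁}(v,v)(t)`.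
This file supplies the elementary majorants of the Duhamel term that the bootstrap consumes,
all in `ℝ≥0∞` (no integrability hypotheses):

* `enorm_oseenDuhamel_le_lintegral` — `‖B_{t₁}(v,v)(t)(x)‖ ≤ ∫⁻_{(t₁,t)} ∫⁻ C₀ E_{t−τ}(x−y)‖v(τ,y)‖² dy dτ`
  with the Koch–Tataru envelope `E_σ(z) = (σ + ‖z‖²)^{−2}` (KNSS 2009 (3.8));
* `lintegral_env_eq` — `∫ E_σ(x − y) dy = I₂ σ^{−1/2}`, `I₂ = ∫(1+‖w‖²)^{−2}`;
* `lintegral_env_compl_ball_le` — `∫_{‖y−x‖ ≥ s} E_σ(x−y) dy ≤ 3|B₁|/s`;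
* time integrals: `lintegral_Ioo_neg_rpow_le` (`∫_{(t₁,t)} (−τ)^{−p} ≤ (−t₁)^{1−p}/(1−p)`),
  `lintegral_Ioo_sub_rpow_half_mul_neg_inv_le` (`∫_{(t₁,t)} (t−τ)^{−1/2}(−τ)^{−1} ≤ 4(−t)^{−1/2}`),
  `lintegral_Ioo_old_exterior_le` (`∫_{(t₁,(1+θ)t)} (−τ)^{−1/2}(t−τ)^{−1} ≤ 4θ^{−1/4}(−t)^{−1/2}`).

References: G. Koch, N. Nadirashvili, G. Seregin, V. Šverák, Acta Math. 203 (2009) =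
arXiv:0709.3599, §3 (3.8), §4 p. 8 [KochNadirashviliSereginSverak2009]; H. Koch, D. Tataru,
Adv. Math. 157 (2001), (14) [KochTataruAdvMath2001].
-/

noncomputable section

-- the summit and its single problem share the name (D-0017 nested layout)
set_option linter.dupNamespace false

namespace Summit.NavierStokesRegularity.NavierStokesRegularity.Theorems.RecurrentReductionD

open MeasureTheory Set Function Filter Topology Metric
open Literature.Analysis Literature.Analysis.FluidPDE
open scoped ENNReal NNReal

/-! ### The Duhamel majorant -/

/-- **The Duhamel term is dominated by the Koch–Tataru envelope**: if
`‖K(σ,z)[a,b]‖ ≤ C₀(σ + ‖z‖²)^{−2}‖a‖‖b‖` then for all `t₁, t, x`,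
`‖B¹_{t₁}(v,v)(t)(x)‖ₑ ≤ ∫⁻_{τ ∈ (t₁,t)} ∫⁻_y C₀((t−τ) + ‖x−y‖²)^{−2} ‖v(τ,y)‖ₑ² dy dτ` (norm of
an integral is at most the lintegral of the norm, twice; no integrability needed).
[cite: KochNadirashviliSereginSverak2009, §3 (3.8) (arXiv:0709.3599 p. 6)] -/
theorem enorm_oseenDuhamel_le_lintegral {C₀ : ℝ} (hC₀ : 0 ≤ C₀)
    (hK : ∀ ⦃σ : ℝ⦄, 0 < σ → ∀ z a b : EuclideanSpace ℝ (Fin 3),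
      ‖oseenKernel σ z a b‖ ≤ C₀ * (σ + ‖z‖ ^ 2) ^ (-(2 : ℝ)) * ‖a‖ * ‖b‖)
    (t₁ t : ℝ) (v : ℝ → EuclideanSpace ℝ (Fin 3) → EuclideanSpace ℝ (Fin 3))
    (x : EuclideanSpace ℝ (Fin 3)) :
    ‖oseenDuhamel 1 t₁ v v t x‖ₑ ≤
      ∫⁻ τ in Ioo t₁ t, ∫⁻ y, ENNReal.ofReal (C₀ * ((t - τ) + ‖x - y‖ ^ 2) ^ (-(2 : ℝ))) *
        ‖v τ y‖ₑ ^ 2 := by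
  rw [oseenDuhamel_apply]
  refine (enorm_integral_le_lintegral_enorm _).trans ?_
  refine setLIntegral_mono' measurableSet_Ioo fun τ hτ => ?_
  have hst : 0 < t - τ := sub_pos.2 hτ.2
  refine (enorm_integral_le_lintegral_enorm _).trans (lintegral_mono fun y => ?_)
  have h := hK hst (x - y) (v τ y) (v τ y)
  have hnn : 0 ≤ C₀ * ((t - τ) + ‖x - y‖ ^ 2) ^ (-(2 : ℝ)) :=
    mul_nonneg hC₀ (Real.rpow_nonneg (by positivity) _)
  rw [one_mul, ← ofReal_norm, ← ofReal_norm, ← ENNReal.ofReal_pow (norm_nonneg _),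
    ← ENNReal.ofReal_mul hnn]
  refine ENNReal.ofReal_le_ofReal ?_
  calc ‖oseenKernel (t - τ) (x - y) (v τ y) (v τ y)‖
      ≤ C₀ * ((t - τ) + ‖x - y‖ ^ 2) ^ (-(2 : ℝ)) * ‖v τ y‖ * ‖v τ y‖ := h
    _ = C₀ * ((t - τ) + ‖x - y‖ ^ 2) ^ (-(2 : ℝ)) * ‖v τ y‖ ^ 2 := by ring

/-! ### Space integrals of the envelope -/

/-- **`∫ (σ + ‖x − y‖²)^{−2} dy = I₂ σ^{−1/2}`**, `I₂ = ∫ (1 + ‖w‖²)^{−2} dw`, for `σ > 0`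
(translation invariance and the parabolic scaling `y = √σ w`, `lintegral_add_norm_sq_rpow_neg`).
[folklore] -/
theorem lintegral_env_eq {σ : ℝ} (hσ : 0 < σ) (x : EuclideanSpace ℝ (Fin 3)) :
    ∫⁻ y, ENNReal.ofReal ((σ + ‖x - y‖ ^ 2) ^ (-(2 : ℝ))) =
      ENNReal.ofReal (σ ^ (-(1 / 2 : ℝ)) *
        ∫ w : EuclideanSpace ℝ (Fin 3), (1 + ‖w‖ ^ 2) ^ (-(2 : ℝ))) := by
  rw [lintegral_sub_left_eq_self (μ := (volume : Measure (EuclideanSpace ℝ (Fin 3))))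
    (fun z : EuclideanSpace ℝ (Fin 3) => ENNReal.ofReal ((σ + ‖z‖ ^ 2) ^ (-(2 : ℝ)))) x]
  have h3 : (Module.finrank ℝ (EuclideanSpace ℝ (Fin 3)) : ℝ) < 2 * 2 := by
    rw [finrank_euclideanSpace_fin]; norm_num
  rw [lintegral_add_norm_sq_rpow_neg h3 hσ, finrank_euclideanSpace_fin]
  norm_num

/-- **`∫_{‖y−x‖ ≥ s} (σ + ‖x−y‖²)^{−2} dy ≤ 3|B₁| s^{−1}`** for `σ > 0`, `s > 0`: the envelope is
at most `‖x − y‖^{−4}` and `∫_{‖z‖ ≥ s} ‖z‖^{−4} dz = 3|B₁| s^{−1}`. [folklore] -/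
theorem lintegral_env_compl_ball_le {σ s : ℝ} (hσ : 0 < σ) (hs : 0 < s)
    (x : EuclideanSpace ℝ (Fin 3)) :
    ∫⁻ y in (ball x s)ᶜ, ENNReal.ofReal ((σ + ‖x - y‖ ^ 2) ^ (-(2 : ℝ))) ≤
      ENNReal.ofReal (3 * (volume : Measure (EuclideanSpace ℝ (Fin 3))).real (ball 0 1) * s⁻¹) := by
  calc ∫⁻ y in (ball x s)ᶜ, ENNReal.ofReal ((σ + ‖x - y‖ ^ 2) ^ (-(2 : ℝ)))
      ≤ ∫⁻ y in (ball x s)ᶜ, ENNReal.ofReal (‖x - y‖ ^ (-(4 : ℝ))) := by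
        refine setLIntegral_mono' measurableSet_ball.compl fun y hy => ?_
        refine ENNReal.ofReal_le_ofReal ?_
        have hy' : s ≤ ‖x - y‖ := by
          rw [mem_compl_iff, mem_ball, dist_eq_norm, not_lt, norm_sub_rev] at hy; exact hy
        have hxy : 0 < ‖x - y‖ := hs.trans_le hy'
        calc (σ + ‖x - y‖ ^ 2) ^ (-(2 : ℝ)) ≤ (‖x - y‖ ^ 2) ^ (-(2 : ℝ)) :=
              Real.rpow_le_rpow_of_nonpos (by positivity) (by linarith) (by norm_num)
          _ = ‖x - y‖ ^ (-(4 : ℝ)) := by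
              rw [← Real.rpow_natCast, ← Real.rpow_mul hxy.le]; norm_num
    _ = ∫⁻ z in (ball (0 : EuclideanSpace ℝ (Fin 3)) s)ᶜ, ENNReal.ofReal (‖z‖ ^ (-(4 : ℝ))) :=
        NewtonPotentialHolder.lintegral_compl_ball_comp_sub_left
          (fun z => ENNReal.ofReal (‖z‖ ^ (-(4 : ℝ)))) x s
    _ = ENNReal.ofReal (3 * (volume : Measure (EuclideanSpace ℝ (Fin 3))).real (ball 0 1) *
          (s ^ (3 - (4 : ℝ)) / ((4 : ℝ) - 3))) :=
        NewtonPotentialHolder.lintegral_compl_ball_norm_rpow_neg (by norm_num) hs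
    _ = ENNReal.ofReal (3 * (volume : Measure (EuclideanSpace ℝ (Fin 3))).real (ball 0 1) * s⁻¹) := by
        congr 1
        rw [show (3 : ℝ) - 4 = -1 by norm_num, show (4 : ℝ) - 3 = 1 by norm_num, div_one,
          Real.rpow_neg_one]

/-! ### Time integrals -/

/-- `∫⁻_{(t₁,t)} (−τ)^{−p} dτ ≤ (−t₁)^{1−p}/(1−p)` for `p < 1`, `t₁ < t ≤ 0` (reflect onto
`(0, −t₁)`). [folklore] -/
theorem lintegral_Ioo_neg_rpow_le {p : ℝ} (hp : p < 1) {t₁ t : ℝ} (ht₁ : t₁ < t) (ht : t ≤ 0) :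
    ∫⁻ τ in Ioo t₁ t, ENNReal.ofReal ((-τ) ^ (-p)) ≤
      ENNReal.ofReal ((-t₁) ^ (1 - p) / (1 - p)) := by
  have hmp : MeasurePreserving (fun τ : ℝ => -τ) volume volume :=
    Measure.measurePreserving_neg volume
  have hemb : MeasurableEmbedding (fun τ : ℝ => -τ) := (MeasurableEquiv.neg ℝ).measurableEmbedding
  have h := hmp.setLIntegral_comp_preimage_emb hemb (fun u => ENNReal.ofReal (u ^ (-p))) (Ioo 0 (-t₁))
  have hpre : (fun τ : ℝ => -τ) ⁻¹' Ioo 0 (-t₁) = Ioo t₁ 0 := by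
    ext τ; simp only [mem_preimage, mem_Ioo]; constructor <;> intro hτ <;> constructor <;> linarith
  rw [hpre] at h
  calc ∫⁻ τ in Ioo t₁ t, ENNReal.ofReal ((-τ) ^ (-p))
      ≤ ∫⁻ τ in Ioo t₁ 0, ENNReal.ofReal ((-τ) ^ (-p)) :=
        lintegral_mono_set (Ioo_subset_Ioo le_rfl ht)
    _ = ∫⁻ u in Ioo 0 (-t₁), ENNReal.ofReal (u ^ (-p)) := h
    _ = ENNReal.ofReal ((-t₁) ^ (1 - p) / (1 - p)) :=
        KatoLp.lintegral_Ioo_rpow_neg hp (by linarith)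

/-- `∫⁻_{(a,b)} u^{q} du ≤ a^{q+1}/(−(q+1))` for `q < −1`, `0 < a ≤ b` (antiderivative
`u^{q+1}/(q+1)`). [folklore] -/
theorem lintegral_Ioo_rpow_le_of_lt_neg_one {a b q : ℝ} (ha : 0 < a) (hab : a ≤ b) (hq : q < -1) :
    ∫⁻ u in Ioo a b, ENNReal.ofReal (u ^ q) ≤ ENNReal.ofReal (a ^ (q + 1) / (-(q + 1))) := by
  have hb : 0 < b := ha.trans_le hab
  have hq1 : 0 < -(q + 1) := by linarith
  have h0 : (0 : ℝ) ∉ uIcc a b := by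
    rw [uIcc_of_le hab]; exact fun h => (lt_irrefl _ (ha.trans_le h.1)).elim
  have hint : IntervalIntegrable (fun u : ℝ => u ^ q) volume a b :=
    intervalIntegral.intervalIntegrable_rpow (Or.inr h0)
  have hval : ∫ u in a..b, u ^ q = (b ^ (q + 1) - a ^ (q + 1)) / (q + 1) :=
    integral_rpow (Or.inr ⟨hq.ne, h0⟩)
  rw [← ofReal_integral_eq_lintegral_ofReal (hint.1.mono_set Ioo_subset_Ioc_self)
    ((ae_restrict_iff' measurableSet_Ioo).2 (Eventually.of_forall fun u hu =>
      Real.rpow_nonneg (ha.trans hu.1).le _)),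
    ← integral_Ioc_eq_integral_Ioo, ← intervalIntegral.integral_of_le hab, hval]
  refine ENNReal.ofReal_le_ofReal ?_
  have hbpow : 0 ≤ b ^ (q + 1) := Real.rpow_nonneg hb.le _
  have e : (b ^ (q + 1) - a ^ (q + 1)) / (q + 1) = (a ^ (q + 1) - b ^ (q + 1)) / (-(q + 1)) := by
    rw [← neg_div_neg_eq, neg_sub]
  rw [e]
  exact div_le_div_of_nonneg_right (by linarith) hq1.le

/-- **`∫⁻_{(t₁,t)} (t−τ)^{−1/2}(−τ)^{−1} dτ ≤ 4(−t)^{−1/2}`** for `t₁ < t < 0`: on `(2t, t)` the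
factor `(−τ)^{−1}` is at most `(−t)^{−1}` and `∫(t−τ)^{−1/2} = 2√(−t)`; on `(t₁, 2t)` one has
`t − τ ≥ −τ/2`, so the integrand is at most `√2 (−τ)^{−3/2}`, whose integral beyond `−τ = −2t` is
`√2(−t)^{−1/2}`. [folklore] -/
theorem lintegral_Ioo_sub_rpow_half_mul_neg_inv_le (t₁ : ℝ) {t : ℝ} (ht : t < 0) :
    ∫⁻ τ in Ioo t₁ t, ENNReal.ofReal ((t - τ) ^ (-(1 / 2 : ℝ)) * (-τ)⁻¹) ≤
      ENNReal.ofReal (4 * (-t) ^ (-(1 / 2 : ℝ))) := by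
  have hnt : 0 < -t := neg_pos.2 ht
  -- split the interval at `2t`
  have hsplit : Ioo t₁ t ⊆ Ioo t₁ (2 * t) ∪ Ico (2 * t) t := by
    intro τ hτ
    by_cases h : τ < 2 * t
    · exact Or.inl ⟨hτ.1, h⟩
    · exact Or.inr ⟨not_lt.1 h, hτ.2⟩
  have hIco : Ico (2 * t) t =ᵐ[volume] Ioo (2 * t) t :=
    (Ioo_ae_eq_Ico (μ := (volume : Measure ℝ)) (a := 2 * t) (b := t)).symm
  -- recent part
  have hrecent : ∫⁻ τ in Ico (2 * t) t, ENNReal.ofReal ((t - τ) ^ (-(1 / 2 : ℝ)) * (-τ)⁻¹) ≤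
      ENNReal.ofReal (2 * (-t) ^ (-(1 / 2 : ℝ))) := by
    rw [setLIntegral_congr hIco]
    calc ∫⁻ τ in Ioo (2 * t) t, ENNReal.ofReal ((t - τ) ^ (-(1 / 2 : ℝ)) * (-τ)⁻¹)
        ≤ ∫⁻ τ in Ioo (2 * t) t, ENNReal.ofReal ((t - τ) ^ (-(1 / 2 : ℝ))) * ENNReal.ofReal ((-t)⁻¹) := by
          refine setLIntegral_mono' measurableSet_Ioo fun τ hτ => ?_
          rw [← ENNReal.ofReal_mul (Real.rpow_nonneg (sub_pos.2 hτ.2).le _)]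
          refine ENNReal.ofReal_le_ofReal (mul_le_mul_of_nonneg_left ?_ (Real.rpow_nonneg (sub_pos.2 hτ.2).le _))
          exact inv_anti₀ hnt (by linarith [hτ.2])
      _ = ENNReal.ofReal (2 * Real.sqrt (t - 2 * t)) * ENNReal.ofReal ((-t)⁻¹) := by
          rw [lintegral_mul_const' _ _ ENNReal.ofReal_ne_top,
            setLIntegral_Ioo_sub_rpow_neg_half_of_lt (by linarith)]
      _ = ENNReal.ofReal (2 * (-t) ^ (-(1 / 2 : ℝ))) := by
          rw [← ENNReal.ofReal_mul (by positivity)]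
          congr 1
          rw [show t - 2 * t = -t by ring, Real.sqrt_eq_rpow, Real.rpow_neg hnt.le]
          have h1 : (-t) ^ (1 / 2 : ℝ) * ((-t) ^ (1 / 2 : ℝ))⁻¹ = 1 :=
            mul_inv_cancel₀ (Real.rpow_pos_of_pos hnt _).ne'
          have h2 : (-t)⁻¹ = ((-t) ^ (1 / 2 : ℝ))⁻¹ * ((-t) ^ (1 / 2 : ℝ))⁻¹ := by
            rw [← mul_inv, ← Real.rpow_add hnt]; norm_num
          rw [h2]
          calc 2 * (-t) ^ (1 / 2 : ℝ) * (((-t) ^ (1 / 2 : ℝ))⁻¹ * ((-t) ^ (1 / 2 : ℝ))⁻¹)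
              = 2 * ((-t) ^ (1 / 2 : ℝ) * ((-t) ^ (1 / 2 : ℝ))⁻¹) * ((-t) ^ (1 / 2 : ℝ))⁻¹ := by ring
            _ = 2 * ((-t) ^ (1 / 2 : ℝ))⁻¹ := by rw [h1, mul_one]
  -- old part
  have hold : ∫⁻ τ in Ioo t₁ (2 * t), ENNReal.ofReal ((t - τ) ^ (-(1 / 2 : ℝ)) * (-τ)⁻¹) ≤
      ENNReal.ofReal (2 * (-t) ^ (-(1 / 2 : ℝ))) := by
    rcases le_or_gt (2 * t) t₁ with h2t | h2t
    · rw [Ioo_eq_empty (not_lt.2 h2t), Measure.restrict_empty, lintegral_zero_measure]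
      exact bot_le
    calc ∫⁻ τ in Ioo t₁ (2 * t), ENNReal.ofReal ((t - τ) ^ (-(1 / 2 : ℝ)) * (-τ)⁻¹)
        ≤ ∫⁻ τ in Ioo t₁ (2 * t), ENNReal.ofReal (Real.sqrt 2 * (-τ) ^ (-(3 / 2 : ℝ))) := by
          refine setLIntegral_mono' measurableSet_Ioo fun τ hτ => ENNReal.ofReal_le_ofReal ?_
          have hτ0 : 0 < -τ := by linarith [hτ.2]
          have hστ : -τ / 2 ≤ t - τ := by linarith [hτ.2]
          have h1 : (t - τ) ^ (-(1 / 2 : ℝ)) ≤ (-τ / 2) ^ (-(1 / 2 : ℝ)) :=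
            Real.rpow_le_rpow_of_nonpos (by positivity) hστ (by norm_num)
          have h2 : (-τ / 2) ^ (-(1 / 2 : ℝ)) = Real.sqrt 2 * (-τ) ^ (-(1 / 2 : ℝ)) := by
            rw [div_eq_mul_inv, Real.mul_rpow hτ0.le (by norm_num), mul_comm]
            congr 1
            rw [Real.sqrt_eq_rpow, Real.inv_rpow (by norm_num : (0:ℝ) ≤ 2), ← Real.rpow_neg_one,
              ← Real.rpow_mul (by norm_num : (0:ℝ) ≤ 2)]
            norm_num
          have h3 : (-τ) ^ (-(1 / 2 : ℝ)) * (-τ)⁻¹ = (-τ) ^ (-(3 / 2 : ℝ)) := by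
            rw [← Real.rpow_neg_one, ← Real.rpow_add hτ0]; norm_num
          calc (t - τ) ^ (-(1 / 2 : ℝ)) * (-τ)⁻¹
              ≤ Real.sqrt 2 * (-τ) ^ (-(1 / 2 : ℝ)) * (-τ)⁻¹ := by
                rw [← h2]; exact mul_le_mul_of_nonneg_right h1 (inv_nonneg.2 hτ0.le)
            _ = Real.sqrt 2 * (-τ) ^ (-(3 / 2 : ℝ)) := by rw [mul_assoc, h3]
      _ = ENNReal.ofReal (Real.sqrt 2) * ∫⁻ τ in Ioo t₁ (2 * t), ENNReal.ofReal ((-τ) ^ (-(3 / 2 : ℝ))) := by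
          rw [← lintegral_const_mul' _ _ ENNReal.ofReal_ne_top]
          refine lintegral_congr fun τ => ?_
          rw [ENNReal.ofReal_mul (Real.sqrt_nonneg _)]
      _ ≤ ENNReal.ofReal (Real.sqrt 2) * ENNReal.ofReal (2 * (2 * (-t)) ^ (-(1 / 2 : ℝ))) := by
          gcongr
          -- reflect onto `(−2t, −t₁)`
          have hmp : MeasurePreserving (fun τ : ℝ => -τ) volume volume :=
            Measure.measurePreserving_neg volume
          have hemb : MeasurableEmbedding (fun τ : ℝ => -τ) :=
            (MeasurableEquiv.neg ℝ).measurableEmbedding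
          have h := hmp.setLIntegral_comp_preimage_emb hemb
            (fun u => ENNReal.ofReal (u ^ (-(3 / 2 : ℝ)))) (Ioo (-(2 * t)) (-t₁))
          have hpre : (fun τ : ℝ => -τ) ⁻¹' Ioo (-(2 * t)) (-t₁) = Ioo t₁ (2 * t) := by
            ext τ; simp only [mem_preimage, mem_Ioo]
            constructor <;> intro hτ <;> constructor <;> linarith
          rw [hpre] at h
          rw [h, show -(2 * t) = 2 * (-t) by ring]
          refine (lintegral_Ioo_rpow_le_of_lt_neg_one (by linarith) (by linarith)
            (by norm_num : (-(3 / 2 : ℝ)) < -1)).trans_eq ?_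
          congr 1
          rw [show -(3 / 2 : ℝ) + 1 = -(1 / 2 : ℝ) by norm_num]
          norm_num
          ring
      _ = ENNReal.ofReal (2 * (-t) ^ (-(1 / 2 : ℝ))) := by
          rw [← ENNReal.ofReal_mul (Real.sqrt_nonneg _)]
          congr 1
          rw [Real.mul_rpow (by norm_num) hnt.le]
          have : Real.sqrt 2 * (2 : ℝ) ^ (-(1 / 2 : ℝ)) = 1 := by
            rw [Real.sqrt_eq_rpow, ← Real.rpow_add (by norm_num : (0:ℝ) < 2)]; norm_num
          calc Real.sqrt 2 * (2 * ((2 : ℝ) ^ (-(1 / 2 : ℝ)) * (-t) ^ (-(1 / 2 : ℝ))))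
              = 2 * (Real.sqrt 2 * (2 : ℝ) ^ (-(1 / 2 : ℝ))) * (-t) ^ (-(1 / 2 : ℝ)) := by ring
            _ = 2 * (-t) ^ (-(1 / 2 : ℝ)) := by rw [this, mul_one]
  calc ∫⁻ τ in Ioo t₁ t, ENNReal.ofReal ((t - τ) ^ (-(1 / 2 : ℝ)) * (-τ)⁻¹)
      ≤ ∫⁻ τ in Ioo t₁ (2 * t) ∪ Ico (2 * t) t, ENNReal.ofReal ((t - τ) ^ (-(1 / 2 : ℝ)) * (-τ)⁻¹) :=
        lintegral_mono_set hsplit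
    _ ≤ (∫⁻ τ in Ioo t₁ (2 * t), ENNReal.ofReal ((t - τ) ^ (-(1 / 2 : ℝ)) * (-τ)⁻¹)) +
          ∫⁻ τ in Ico (2 * t) t, ENNReal.ofReal ((t - τ) ^ (-(1 / 2 : ℝ)) * (-τ)⁻¹) :=
        lintegral_union_le _ _ _
    _ ≤ ENNReal.ofReal (2 * (-t) ^ (-(1 / 2 : ℝ))) + ENNReal.ofReal (2 * (-t) ^ (-(1 / 2 : ℝ))) :=
        add_le_add hold hrecent
    _ = ENNReal.ofReal (4 * (-t) ^ (-(1 / 2 : ℝ))) := by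
        rw [← ENNReal.ofReal_add (by positivity) (by positivity)]; congr 1; ring

/-- **The old part of the exterior time integral**: for `θ > 0`, `t < 0`,
`∫⁻_{(t₁,(1+θ)t)} (−τ)^{−1/2}(t−τ)^{−1} dτ ≤ 4θ^{−1/4}(−t)^{−1/2}`: on this range `σ = t − τ ≥ θ(−t)`
and `−τ ≥ max(−t, σ)`, so `(−τ)^{−1/2} ≤ (−t)^{−1/4}σ^{−1/4}`, and `∫_{σ ≥ θ(−t)} σ^{−5/4} dσ ≤
4(θ(−t))^{−1/4}`. [folklore] -/
theorem lintegral_Ioo_old_exterior_le (t₁ : ℝ) {θ t : ℝ} (hθ : 0 < θ) (ht : t < 0) :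
    ∫⁻ τ in Ioo t₁ ((1 + θ) * t), ENNReal.ofReal ((-τ) ^ (-(1 / 2 : ℝ)) * (t - τ)⁻¹) ≤
      ENNReal.ofReal (4 * θ ^ (-(1 / 4 : ℝ)) * (-t) ^ (-(1 / 2 : ℝ))) := by
  have hnt : 0 < -t := neg_pos.2 ht
  have hθt : 0 < θ * (-t) := mul_pos hθ hnt
  rcases le_or_gt ((1 + θ) * t) t₁ with hle | hlt
  · rw [Ioo_eq_empty (not_lt.2 hle), Measure.restrict_empty, lintegral_zero_measure]
    exact bot_le
  -- pointwise bound
  have hpt : ∀ τ ∈ Ioo t₁ ((1 + θ) * t),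
      ENNReal.ofReal ((-τ) ^ (-(1 / 2 : ℝ)) * (t - τ)⁻¹) ≤
        ENNReal.ofReal ((-t) ^ (-(1 / 4 : ℝ))) * ENNReal.ofReal ((t - τ) ^ (-(5 / 4 : ℝ))) := by
    intro τ hτ
    have hσ : θ * (-t) < t - τ := by nlinarith [hτ.2]
    have hσ0 : 0 < t - τ := hθt.trans hσ
    have hτ0 : 0 < -τ := by linarith
    rw [← ENNReal.ofReal_mul (Real.rpow_nonneg hnt.le _)]
    refine ENNReal.ofReal_le_ofReal ?_
    have h1 : (-τ) ^ (-(1 / 4 : ℝ)) ≤ (-t) ^ (-(1 / 4 : ℝ)) :=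
      Real.rpow_le_rpow_of_nonpos hnt (by linarith) (by norm_num)
    have h2 : (-τ) ^ (-(1 / 4 : ℝ)) ≤ (t - τ) ^ (-(1 / 4 : ℝ)) :=
      Real.rpow_le_rpow_of_nonpos hσ0 (by linarith) (by norm_num)
    have h12 : (-τ) ^ (-(1 / 2 : ℝ)) = (-τ) ^ (-(1 / 4 : ℝ)) * (-τ) ^ (-(1 / 4 : ℝ)) := by
      rw [← Real.rpow_add hτ0]; norm_num
    have h3 : (t - τ)⁻¹ = (t - τ) ^ (-(1 : ℝ)) := (Real.rpow_neg_one _).symm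
    have h4 : (t - τ) ^ (-(1 / 4 : ℝ)) * (t - τ) ^ (-(1 : ℝ)) = (t - τ) ^ (-(5 / 4 : ℝ)) := by
      rw [← Real.rpow_add hσ0]; norm_num
    calc (-τ) ^ (-(1 / 2 : ℝ)) * (t - τ)⁻¹
        = (-τ) ^ (-(1 / 4 : ℝ)) * (-τ) ^ (-(1 / 4 : ℝ)) * (t - τ) ^ (-(1 : ℝ)) := by rw [h12, h3]
      _ ≤ (-t) ^ (-(1 / 4 : ℝ)) * (t - τ) ^ (-(1 / 4 : ℝ)) * (t - τ) ^ (-(1 : ℝ)) := by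
          gcongr
      _ = (-t) ^ (-(1 / 4 : ℝ)) * (t - τ) ^ (-(5 / 4 : ℝ)) := by rw [mul_assoc, h4]
  -- the `σ`-integral by reflection
  have hmp : MeasurePreserving (fun τ : ℝ => t - τ) volume volume :=
    Measure.measurePreserving_sub_left volume t
  have hemb : MeasurableEmbedding (fun τ : ℝ => t - τ) :=
    (MeasurableEquiv.subLeft t).measurableEmbedding
  have href := hmp.setLIntegral_comp_preimage_emb hemb
    (fun σ => ENNReal.ofReal (σ ^ (-(5 / 4 : ℝ)))) (Ioo (θ * (-t)) (t - t₁))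
  have hpre : (fun τ : ℝ => t - τ) ⁻¹' Ioo (θ * (-t)) (t - t₁) = Ioo t₁ ((1 + θ) * t) := by
    ext τ; simp only [mem_preimage, mem_Ioo]
    constructor <;> intro hτ <;> constructor <;> nlinarith [hτ.1, hτ.2]
  rw [hpre] at href
  calc ∫⁻ τ in Ioo t₁ ((1 + θ) * t), ENNReal.ofReal ((-τ) ^ (-(1 / 2 : ℝ)) * (t - τ)⁻¹)
      ≤ ∫⁻ τ in Ioo t₁ ((1 + θ) * t),
          ENNReal.ofReal ((-t) ^ (-(1 / 4 : ℝ))) * ENNReal.ofReal ((t - τ) ^ (-(5 / 4 : ℝ))) :=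
        setLIntegral_mono' measurableSet_Ioo hpt
    _ = ENNReal.ofReal ((-t) ^ (-(1 / 4 : ℝ))) *
          ∫⁻ σ in Ioo (θ * (-t)) (t - t₁), ENNReal.ofReal (σ ^ (-(5 / 4 : ℝ))) := by
        rw [lintegral_const_mul' _ _ ENNReal.ofReal_ne_top, href]
    _ ≤ ENNReal.ofReal ((-t) ^ (-(1 / 4 : ℝ))) *
          ENNReal.ofReal ((θ * (-t)) ^ (-(5 / 4 : ℝ) + 1) / (-(-(5 / 4 : ℝ) + 1))) := by
        gcongr
        exact lintegral_Ioo_rpow_le_of_lt_neg_one hθt (by nlinarith) (by norm_num)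
    _ = ENNReal.ofReal (4 * θ ^ (-(1 / 4 : ℝ)) * (-t) ^ (-(1 / 2 : ℝ))) := by
        rw [← ENNReal.ofReal_mul (Real.rpow_nonneg hnt.le _)]
        congr 1
        rw [show -(5 / 4 : ℝ) + 1 = -(1 / 4 : ℝ) by norm_num, Real.mul_rpow hθ.le hnt.le]
        have e : (-t) ^ (-(1 / 4 : ℝ)) * (-t) ^ (-(1 / 4 : ℝ)) = (-t) ^ (-(1 / 2 : ℝ)) := by
          rw [← Real.rpow_add hnt]; norm_num
        rw [show -(-(1 / 4 : ℝ)) = 1 / 4 by norm_num]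
        calc (-t) ^ (-(1 / 4 : ℝ)) * (θ ^ (-(1 / 4 : ℝ)) * (-t) ^ (-(1 / 4 : ℝ)) / (1 / 4))
            = 4 * θ ^ (-(1 / 4 : ℝ)) * ((-t) ^ (-(1 / 4 : ℝ)) * (-t) ^ (-(1 / 4 : ℝ))) := by ring
          _ = 4 * θ ^ (-(1 / 4 : ℝ)) * (-t) ^ (-(1 / 2 : ℝ)) := by rw [e]

/-- **The recent part of the exterior time integral**: `∫⁻_{((1+θ)t, t)} (t−τ)^{−1/2} dτ =
2√(θ(−t))` (`θ > 0`, `t < 0`). [folklore] -/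
theorem lintegral_Ioo_recent_eq {θ t : ℝ} (hθ : 0 < θ) (ht : t < 0) :
    ∫⁻ τ in Ioo ((1 + θ) * t) t, ENNReal.ofReal ((t - τ) ^ (-(1 / 2 : ℝ))) =
      ENNReal.ofReal (2 * Real.sqrt (θ * (-t))) := by
  have hlt : (1 + θ) * t < t := by nlinarith
  rw [setLIntegral_Ioo_sub_rpow_neg_half_of_lt hlt]
  congr 2
  ring

/-! ### Parabolic separation -/

/-- Parabolic separation: if `‖x‖ < R + M√(−t)` and `‖y‖ ≥ R + M√(−τ)` with `τ < t < 0`, `M > 0`,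
then `‖y − x‖ ≥ M(t−τ)/(2√(−τ))` (since `√(−τ) − √(−t) = (t−τ)/(√(−τ)+√(−t)) ≥ (t−τ)/(2√(−τ))`).
[folklore] -/
theorem parabolic_separation {R M t τ : ℝ} (hM : 0 < M) (hτt : τ < t) (ht : t < 0)
    {x y : EuclideanSpace ℝ (Fin 3)} (hx : ‖x‖ < R + M * Real.sqrt (-t))
    (hy : R + M * Real.sqrt (-τ) ≤ ‖y‖) :
    y ∈ (ball x (M * (t - τ) / (2 * Real.sqrt (-τ))))ᶜ := by
  have hτ0 : 0 < -τ := by linarith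
  have hst : 0 < Real.sqrt (-t) := Real.sqrt_pos.2 (by linarith)
  have hsτ : 0 < Real.sqrt (-τ) := Real.sqrt_pos.2 hτ0
  have hle : Real.sqrt (-t) ≤ Real.sqrt (-τ) := Real.sqrt_le_sqrt (by linarith)
  rw [mem_compl_iff, mem_ball, not_lt, dist_eq_norm]
  have h1 : M * (Real.sqrt (-τ) - Real.sqrt (-t)) ≤ ‖y - x‖ := by
    have := norm_sub_norm_le y x
    nlinarith [norm_sub_norm_le y x]
  have h2 : (Real.sqrt (-τ) - Real.sqrt (-t)) * (Real.sqrt (-τ) + Real.sqrt (-t)) = t - τ := by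
    have a := Real.mul_self_sqrt hτ0.le
    have b := Real.mul_self_sqrt (neg_pos.2 ht).le
    nlinarith
  have h3 : t - τ ≤ (Real.sqrt (-τ) - Real.sqrt (-t)) * (2 * Real.sqrt (-τ)) := by
    rw [← h2]
    exact mul_le_mul_of_nonneg_left (by linarith) (by linarith)
  have h4 : M * (t - τ) / (2 * Real.sqrt (-τ)) ≤ M * (Real.sqrt (-τ) - Real.sqrt (-t)) := by
    rw [div_le_iff₀ (by positivity)]
    calc M * (t - τ) ≤ M * ((Real.sqrt (-τ) - Real.sqrt (-t)) * (2 * Real.sqrt (-τ))) :=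
          mul_le_mul_of_nonneg_left h3 hM.le
      _ = M * (Real.sqrt (-τ) - Real.sqrt (-t)) * (2 * Real.sqrt (-τ)) := by ring
  exact h4.trans h1

end Summit.NavierStokesRegularity.NavierStokesRegularity.Theorems.RecurrentReductionD

end
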